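import Summits.Ventures.PercRepro.C025ProfileTwoFlatPLDPairsA
import Summits.Ventures.PercRepro.C025ProfileTwoFlatPLDPairsB

/-!
# PER-LAYER DOMINANCE (PLD) ON TWO UNIFORM FLATS: THE INJECTION (night-3 g27)

`proofs/NIGHT3-G27-PLD.md` §2 and §4.  Ground set `F₁ ⊔ F₂`, rank `ρ(X) = min(|X ∩ F₁|, s₁) + min(|X ∩ F₂|, s₂)`
(two uniform flats, no free points — the free points enter through the layer-cake, `C025ProfileLayerCake`), with a
KEPT-POINT SELECTOR per flat (`J X ⊆ X`, `#J X = min #X s`, hereditary: `X' ⊆ X → J X ∩ X' ⊆ J X'`; the «`s` smallest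
elements» qualify).  A PAIR is `(I, D)` with `D ⊆ J(E ∖ I)`; its rank `x = ρ(I)`, corank `f = ρ(E ∖ I)`, `δ = #D`.
In SOURCE coordinates the slots `(J, Q)` of the rows of (Π) are the pairs with `f ∈ [lo+δ, hi+δ]`
(`(J, Q) ↔ (E ∖ J, J₀(J) ∖ Q)`), so per-layer dominance `#{x ∈ [lo,hi], f ≥ lo+hi+δ−x} ≤ #{f ∈ [lo+δ, hi+δ]}` reduces,
the pairs with `f ≤ hi + δ` being their own slots, to the RESIDUAL inequality
  `#RS ≤ #THI`,  `RS = {x ∈ [lo,hi], f ≥ hi+δ+1}`,  `THI = {f ∈ [lo+δ, hi+δ], x ≥ hi+1}`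
(`card_RS_le_card_THI`), proved by an explicit injection `Ψ`:
* a flat OVERFLOWS when `c + δ > s`; in `RS` at most one flat overflows;
* no overflow: `Ψ(I, D) = (E ∖ (I ∪ D), D)`;
* overflow on flat `o` with partner `p`, `o := c_o + δ_o − f_o ≥ 1`, absorber `Y = φ(I_p)` (the level-raising injection
  of `C025ProfileLevelInj` on `F_p ∖ D_p`, level `#I_p → #I_p + o`): `Ψ = (I_o ⊔ (F_p ∖ Y ∖ D_p), D)` — unless this is the
  N-image of a non-overflowing residual pair `C = (F_o ∖ I_o ∖ D_o ⊔ Y, D)` («blocked»), in which case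
  `Ψ = (F_o ∖ I_o ∖ D_o ⊔ (F_p ∖ Y' ∖ D_p), D)` with `Y' = φ(I_p)` at level `#I_p + o'`, `o' := c_o + δ_o − s_o`.
Membership is `N_flat` / `S_mem` / `L_mem` (`C025ProfileTwoFlatPLDLemmas`); injectivity is the case analysis on the two
kinds through the pair lemmas of `C025ProfileTwoFlatPLDMoves`, `…PairsA`, `…PairsB`.  Verified beforehand on 20,199
instances (lab/twoflat_rule2.py).  No `def`, no `instance`, no notation.  Axioms: standard.
-/

namespace PercRepro

namespace TwoFlatPLD

open Finset

section Main

variable {α β : Type} [DecidableEq α] [DecidableEq β]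

/-- **THE TWO-FLAT INJECTION**: `#RS ≤ #THI` for `U_{s₁,F₁} ⊕ U_{s₂,F₂}` with per-flat kept-point selectors `J₁, J₂`
(`J X ⊆ X`, `#J X = min #X s`, hereditary).  `RS` = the residual sources `(I, D)` (`D ⊆ J(F ∖ I)`, `#D = δ`,
`lo ≤ ρ(I) ≤ hi`, `ρ(E ∖ I) ≥ hi + δ + 1`), `THI` = the pairs with `lo + δ ≤ ρ(E ∖ I) ≤ hi + δ` and `ρ(I) ≥ hi + 1`;
both given by their membership characterisations. -/
theorem card_RS_le_card_THI
    (F₁ : Finset α) (F₂ : Finset β) (s₁ s₂ : ℕ) (J₁ : Finset α → Finset α) (J₂ : Finset β → Finset β)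
    (hJ₁ : ∀ X, J₁ X ⊆ X) (hc₁ : ∀ X, (J₁ X).card = min X.card s₁)
    (hh₁ : ∀ X X', X' ⊆ X → J₁ X ∩ X' ⊆ J₁ X')
    (hJ₂ : ∀ X, J₂ X ⊆ X) (hc₂ : ∀ X, (J₂ X).card = min X.card s₂)
    (hh₂ : ∀ X X', X' ⊆ X → J₂ X ∩ X' ⊆ J₂ X')
    (lo hi δ : ℕ) (RS THI : Finset ((Finset α × Finset α) × (Finset β × Finset β)))
    (hRS : ∀ σ, σ ∈ RS ↔ σ.1.1 ⊆ F₁ ∧ σ.2.1 ⊆ F₂ ∧ σ.1.2 ⊆ J₁ (F₁ \ σ.1.1) ∧ σ.2.2 ⊆ J₂ (F₂ \ σ.2.1) ∧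
        σ.1.2.card + σ.2.2.card = δ ∧ lo ≤ min σ.1.1.card s₁ + min σ.2.1.card s₂ ∧
        min σ.1.1.card s₁ + min σ.2.1.card s₂ ≤ hi ∧
        hi + δ + 1 ≤ min (F₁.card - σ.1.1.card) s₁ + min (F₂.card - σ.2.1.card) s₂)
    (hTHI : ∀ σ, σ ∈ THI ↔ σ.1.1 ⊆ F₁ ∧ σ.2.1 ⊆ F₂ ∧ σ.1.2 ⊆ J₁ (F₁ \ σ.1.1) ∧ σ.2.2 ⊆ J₂ (F₂ \ σ.2.1) ∧
        σ.1.2.card + σ.2.2.card = δ ∧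
        lo + δ ≤ min (F₁.card - σ.1.1.card) s₁ + min (F₂.card - σ.2.1.card) s₂ ∧
        min (F₁.card - σ.1.1.card) s₁ + min (F₂.card - σ.2.1.card) s₂ ≤ hi + δ ∧
        hi + 1 ≤ min σ.1.1.card s₁ + min σ.2.1.card s₂) :
    RS.card ≤ THI.card := by
  classical
  -- the level-raising injections (Hall), as functions of the ambient set and the two levels
  have hex₁ : ∀ (S : Finset α) (i j : ℕ), ∃ φ : Finset α → Finset α, i ≤ j → i + j ≤ S.card →
      (Set.InjOn φ (S.powersetCard i) ∧ ∀ I ∈ S.powersetCard i, φ I ∈ S.powersetCard j ∧ I ⊆ φ I) := by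
    intro S i j
    by_cases h : i ≤ j ∧ i + j ≤ S.card
    · obtain ⟨φ, hφ⟩ := LevelInj.exists_injOn_powersetCard_subset S h.1 h.2
      exact ⟨φ, fun _ _ => hφ⟩
    · exact ⟨id, fun h1 h2 => absurd ⟨h1, h2⟩ h⟩
  have hex₂ : ∀ (S : Finset β) (i j : ℕ), ∃ φ : Finset β → Finset β, i ≤ j → i + j ≤ S.card →
      (Set.InjOn φ (S.powersetCard i) ∧ ∀ I ∈ S.powersetCard i, φ I ∈ S.powersetCard j ∧ I ⊆ φ I) := by
    intro S i j
    by_cases h : i ≤ j ∧ i + j ≤ S.card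
    · obtain ⟨φ, hφ⟩ := LevelInj.exists_injOn_powersetCard_subset S h.1 h.2
      exact ⟨φ, fun _ _ => hφ⟩
    · exact ⟨id, fun h1 h2 => absurd ⟨h1, h2⟩ h⟩
  choose φ₁ hφ₁ using hex₁
  choose φ₂ hφ₂ using hex₂
  -- the moves
  set o₁ : (Finset α × Finset α) × (Finset β × Finset β) → ℕ :=
    fun σ => min σ.1.1.card s₁ + σ.1.2.card - min (F₁.card - σ.1.1.card) s₁ with ho₁
  set o₁' : (Finset α × Finset α) × (Finset β × Finset β) → ℕ :=
    fun σ => min σ.1.1.card s₁ + σ.1.2.card - s₁ with ho₁'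
  set o₂ : (Finset α × Finset α) × (Finset β × Finset β) → ℕ :=
    fun σ => min σ.2.1.card s₂ + σ.2.2.card - min (F₂.card - σ.2.1.card) s₂ with ho₂
  set o₂' : (Finset α × Finset α) × (Finset β × Finset β) → ℕ :=
    fun σ => min σ.2.1.card s₂ + σ.2.2.card - s₂ with ho₂'
  set YS₁ : (Finset α × Finset α) × (Finset β × Finset β) → Finset β :=
    fun σ => φ₂ (F₂ \ σ.2.2) σ.2.1.card (σ.2.1.card + o₁ σ) σ.2.1 with hYS₁
  set YL₁ : (Finset α × Finset α) × (Finset β × Finset β) → Finset β :=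
    fun σ => φ₂ (F₂ \ σ.2.2) σ.2.1.card (σ.2.1.card + o₁' σ) σ.2.1 with hYL₁
  set YS₂ : (Finset α × Finset α) × (Finset β × Finset β) → Finset α :=
    fun σ => φ₁ (F₁ \ σ.1.2) σ.1.1.card (σ.1.1.card + o₂ σ) σ.1.1 with hYS₂
  set YL₂ : (Finset α × Finset α) × (Finset β × Finset β) → Finset α :=
    fun σ => φ₁ (F₁ \ σ.1.2) σ.1.1.card (σ.1.1.card + o₂' σ) σ.1.1 with hYL₂
  -- the images
  set N : (Finset α × Finset α) × (Finset β × Finset β) → (Finset α × Finset α) × (Finset β × Finset β) :=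
    fun σ => (((F₁ \ σ.1.1) \ σ.1.2, σ.1.2), ((F₂ \ σ.2.1) \ σ.2.2, σ.2.2)) with hN
  set C₁ : (Finset α × Finset α) × (Finset β × Finset β) → (Finset α × Finset α) × (Finset β × Finset β) :=
    fun σ => (((F₁ \ σ.1.1) \ σ.1.2, σ.1.2), (YS₁ σ, σ.2.2)) with hC₁
  set S₁ : (Finset α × Finset α) × (Finset β × Finset β) → (Finset α × Finset α) × (Finset β × Finset β) :=
    fun σ => ((σ.1.1, σ.1.2), ((F₂ \ YS₁ σ) \ σ.2.2, σ.2.2)) with hS₁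
  set L₁ : (Finset α × Finset α) × (Finset β × Finset β) → (Finset α × Finset α) × (Finset β × Finset β) :=
    fun σ => (((F₁ \ σ.1.1) \ σ.1.2, σ.1.2), ((F₂ \ YL₁ σ) \ σ.2.2, σ.2.2)) with hL₁
  set C₂ : (Finset α × Finset α) × (Finset β × Finset β) → (Finset α × Finset α) × (Finset β × Finset β) :=
    fun σ => ((YS₂ σ, σ.1.2), ((F₂ \ σ.2.1) \ σ.2.2, σ.2.2)) with hC₂
  set S₂ : (Finset α × Finset α) × (Finset β × Finset β) → (Finset α × Finset α) × (Finset β × Finset β) :=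
    fun σ => (((F₁ \ YS₂ σ) \ σ.1.2, σ.1.2), (σ.2.1, σ.2.2)) with hS₂
  set L₂ : (Finset α × Finset α) × (Finset β × Finset β) → (Finset α × Finset α) × (Finset β × Finset β) :=
    fun σ => (((F₁ \ YL₂ σ) \ σ.1.2, σ.1.2), ((F₂ \ σ.2.1) \ σ.2.2, σ.2.2)) with hL₂
  -- overflow and blocking
  set ov₁ : (Finset α × Finset α) × (Finset β × Finset β) → Prop :=
    fun σ => s₁ < min σ.1.1.card s₁ + σ.1.2.card with hov₁
  set ov₂ : (Finset α × Finset α) × (Finset β × Finset β) → Prop :=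
    fun σ => s₂ < min σ.2.1.card s₂ + σ.2.2.card with hov₂
  set blk₁ : (Finset α × Finset α) × (Finset β × Finset β) → Prop :=
    fun σ => C₁ σ ∈ RS ∧ ¬ ov₁ (C₁ σ) ∧ ¬ ov₂ (C₁ σ) with hblk₁
  set blk₂ : (Finset α × Finset α) × (Finset β × Finset β) → Prop :=
    fun σ => C₂ σ ∈ RS ∧ ¬ ov₁ (C₂ σ) ∧ ¬ ov₂ (C₂ σ) with hblk₂
  let Ψ : (Finset α × Finset α) × (Finset β × Finset β) → (Finset α × Finset α) × (Finset β × Finset β) :=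
    fun σ => if ov₁ σ then (if blk₁ σ then L₁ σ else S₁ σ)
      else if ov₂ σ then (if blk₂ σ then L₂ σ else S₂ σ) else N σ
  have hmaps : ∀ σ ∈ RS, Ψ σ ∈ THI := by
    intro σ hσ
    obtain ⟨hI₁, hI₂, hD₁, hD₂, hδ, hlo, hhi, hf⟩ := (hRS σ).1 hσ
    have hD₁F : σ.1.2 ⊆ F₁ \ σ.1.1 := hD₁.trans (hJ₁ _)
    have hD₂F : σ.2.2 ⊆ F₂ \ σ.2.1 := hD₂.trans (hJ₂ _)
    show (if ov₁ σ then (if blk₁ σ then L₁ σ else S₁ σ)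
      else if ov₂ σ then (if blk₂ σ then L₂ σ else S₂ σ) else N σ) ∈ THI
    by_cases h1 : ov₁ σ
    · rw [if_pos h1]
      by_cases hb : blk₁ σ
      · -- L₁
        rw [if_pos hb]
        obtain ⟨b1, b2, b3⟩ := blocked_facts₁ F₁ F₂ s₁ s₂ J₁ J₂ hJ₁ hJ₂ lo hi δ RS hRS φ₂ hφ₂ σ hσ h1 hb
        obtain ⟨y1, y2, y3, -, -⟩ := absorb_L₁ F₁ F₂ s₁ s₂ J₁ J₂ hJ₂ lo hi δ RS hRS φ₂ hφ₂ σ hσ h1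
        have hov : s₁ < min σ.1.1.card s₁ + σ.1.2.card := h1
        obtain ⟨m1, m2, m3, m4, m5, m6, m7⟩ := L_mem F₁ s₁ J₁ F₂ s₂ J₂ hJ₂ hc₂ (lo := lo) (hi := hi) (δ := δ)
          hI₁ hD₁F hI₂ hD₂ hδ hlo hhi hf hov b1 b2 (by simpa only [ho₁] using b3) y1 (by simpa only [ho₁'] using y2)
        rw [hTHI]
        simp only [hL₁, hYL₁, ho₁']
        exact ⟨m1, m3, m2, m4, hδ, m5, m6, m7⟩
      · -- S₁
        rw [if_neg hb]
        obtain ⟨y1, y2, y3, -, -⟩ := absorb_S₁ F₁ F₂ s₁ s₂ J₁ J₂ hJ₂ lo hi δ RS hRS φ₂ hφ₂ σ hσ h1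
        have hov : s₁ < min σ.1.1.card s₁ + σ.1.2.card := h1
        obtain ⟨m1, m2, m3, m4, m5⟩ := S_mem F₁ s₁ F₂ s₂ J₂ hJ₂ hc₂ (lo := lo) (hi := hi) (δ := δ)
          hI₁ hI₂ hD₂ hδ hlo hhi hf hov y1 (by simpa only [ho₁] using y2)
        rw [hTHI]
        simp only [hS₁, hYS₁, ho₁]
        exact ⟨hI₁, m1, hD₁, m2, hδ, m3, m4, m5⟩
    · rw [if_neg h1]
      by_cases h2 : ov₂ σ
      · rw [if_pos h2]
        by_cases hb : blk₂ σ
        · -- L₂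
          rw [if_pos hb]
          obtain ⟨b1, b2, b3⟩ := blocked_facts₂ F₁ F₂ s₁ s₂ J₁ J₂ hJ₁ hJ₂ lo hi δ RS hRS φ₁ hφ₁ σ hσ h2 hb
          obtain ⟨y1, y2, y3, -, -⟩ := absorb_L₂ F₁ F₂ s₁ s₂ J₁ J₂ hJ₁ lo hi δ RS hRS φ₁ hφ₁ σ hσ h2
          have hov : s₂ < min σ.2.1.card s₂ + σ.2.2.card := h2
          obtain ⟨m1, m2, m3, m4, m5, m6, m7⟩ := L_mem F₂ s₂ J₂ F₁ s₁ J₁ hJ₁ hc₁ (lo := lo) (hi := hi) (δ := δ)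
            hI₂ hD₂F hI₁ hD₁ (by omega) (by omega) (by omega) (by omega) hov b1 b2
            (by simpa only [ho₂] using b3) y1 (by simpa only [ho₂'] using y2)
          rw [hTHI]
          simp only [hL₂, hYL₂, ho₂']
          exact ⟨m3, m1, m4, m2, hδ, by omega, by omega, by omega⟩
        · -- S₂
          rw [if_neg hb]
          obtain ⟨y1, y2, y3, -, -⟩ := absorb_S₂ F₁ F₂ s₁ s₂ J₁ J₂ hJ₁ lo hi δ RS hRS φ₁ hφ₁ σ hσ h2
          have hov : s₂ < min σ.2.1.card s₂ + σ.2.2.card := h2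
          obtain ⟨m1, m2, m3, m4, m5⟩ := S_mem F₂ s₂ F₁ s₁ J₁ hJ₁ hc₁ (lo := lo) (hi := hi) (δ := δ)
            hI₂ hI₁ hD₁ (by omega) (by omega) (by omega) (by omega) hov y1 (by simpa only [ho₂] using y2)
          rw [hTHI]
          simp only [hS₂, hYS₂, ho₂]
          exact ⟨m1, hI₂, m2, hD₂, hδ, by omega, by omega, by omega⟩
      · -- N
        rw [if_neg h2]
        have hnov1 : min σ.1.1.card s₁ + σ.1.2.card ≤ s₁ := by simp only [hov₁] at h1; omega
        have hnov2 : min σ.2.1.card s₂ + σ.2.2.card ≤ s₂ := by simp only [hov₂] at h2; omega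
        obtain ⟨n1, n2, n3, n4⟩ := N_flat hJ₁ hc₁ hI₁ hD₁ hnov1
        obtain ⟨n5, n6, n7, n8⟩ := N_flat hJ₂ hc₂ hI₂ hD₂ hnov2
        rw [hTHI]
        simp only [hN]
        exact ⟨n1, n5, n2, n6, hδ, by omega, by omega, by omega⟩
  have hinj : Set.InjOn Ψ (RS : Set ((Finset α × Finset α) × (Finset β × Finset β))) := by
    intro σ hσ τ hτ h
    rw [mem_coe] at hσ hτ
    have hΨ : ∀ ρ, Ψ ρ = if ov₁ ρ then (if blk₁ ρ then L₁ ρ else S₁ ρ)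
      else if ov₂ ρ then (if blk₂ ρ then L₂ ρ else S₂ ρ) else N ρ := fun ρ => rfl
    rw [hΨ σ, hΨ τ] at h
    by_cases s1 : ov₁ σ
    · rw [if_pos s1] at h
      by_cases sb : blk₁ σ
      · rw [if_pos sb] at h
        by_cases t1 : ov₁ τ
        · rw [if_pos t1] at h
          by_cases tb : blk₁ τ
          · rw [if_pos tb] at h; exact L₁_eq_L₁ F₁ F₂ s₁ s₂ J₁ J₂ hJ₁ hJ₂ lo hi δ RS hRS φ₂ hφ₂ σ τ hσ hτ s1 t1 h
          · rw [if_neg tb] at h; exact (S₁_ne_L₁ F₁ F₂ s₁ s₂ RS φ₂ τ σ t1 sb h.symm).elim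
        · rw [if_neg t1] at h
          by_cases t2 : ov₂ τ
          · rw [if_pos t2] at h
            by_cases tb : blk₂ τ
            · rw [if_pos tb] at h; exact (L₁_ne_L₂ F₁ F₂ s₁ s₂ J₁ J₂ hJ₁ lo hi δ RS hRS φ₁ hφ₁ φ₂ σ τ hσ hτ s1 t2 h).elim
            · rw [if_neg tb] at h; exact (L₁_ne_S₂ F₁ F₂ s₁ s₂ J₁ J₂ hJ₁ lo hi δ RS hRS φ₁ hφ₁ φ₂ σ τ hσ hτ s1 t2 h).elim
          · rw [if_neg t2] at h; exact (N_ne_L₁ F₁ F₂ s₁ s₂ J₁ J₂ hJ₁ lo hi δ RS hRS φ₂ τ σ hτ hσ t1 s1 h.symm).elim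
      · rw [if_neg sb] at h
        by_cases t1 : ov₁ τ
        · rw [if_pos t1] at h
          by_cases tb : blk₁ τ
          · rw [if_pos tb] at h; exact (S₁_ne_L₁ F₁ F₂ s₁ s₂ RS φ₂ σ τ s1 tb h).elim
          · rw [if_neg tb] at h; exact S₁_eq_S₁ F₁ F₂ s₁ s₂ J₁ J₂ hJ₂ lo hi δ RS hRS φ₂ hφ₂ σ τ hσ hτ s1 t1 h
        · rw [if_neg t1] at h
          by_cases t2 : ov₂ τ
          · rw [if_pos t2] at h
            by_cases tb : blk₂ τ
            · rw [if_pos tb] at h; exact (S₁_ne_L₂ F₁ F₂ s₁ s₂ J₁ J₂ hJ₂ lo hi δ RS hRS φ₁ φ₂ hφ₂ σ τ hσ hτ s1 t2 h).elim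
            · rw [if_neg tb] at h; exact (S₁_ne_S₂ F₁ F₂ s₁ s₂ J₁ J₂ hJ₁ hh₁ hJ₂ hh₂ lo hi δ RS hRS φ₁ hφ₁ φ₂ hφ₂ σ τ hσ hτ s1 sb t2 h).elim
          · rw [if_neg t2] at h; exact (N_ne_S₁ F₁ F₂ s₁ s₂ J₁ J₂ hJ₁ hJ₂ lo hi δ RS hRS φ₂ hφ₂ τ σ hτ hσ t1 t2 s1 sb h.symm).elim
    · rw [if_neg s1] at h
      by_cases s2 : ov₂ σ
      · rw [if_pos s2] at h
        by_cases sb : blk₂ σ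
        · rw [if_pos sb] at h
          by_cases t1 : ov₁ τ
          · rw [if_pos t1] at h
            by_cases tb : blk₁ τ
            · rw [if_pos tb] at h; exact (L₁_ne_L₂ F₁ F₂ s₁ s₂ J₁ J₂ hJ₁ lo hi δ RS hRS φ₁ hφ₁ φ₂ τ σ hτ hσ t1 s2 h.symm).elim
            · rw [if_neg tb] at h; exact (S₁_ne_L₂ F₁ F₂ s₁ s₂ J₁ J₂ hJ₂ lo hi δ RS hRS φ₁ φ₂ hφ₂ τ σ hτ hσ t1 s2 h.symm).elim
          · rw [if_neg t1] at h
            by_cases t2 : ov₂ τ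
            · rw [if_pos t2] at h
              by_cases tb : blk₂ τ
              · rw [if_pos tb] at h; exact L₂_eq_L₂ F₁ F₂ s₁ s₂ J₁ J₂ hJ₁ hJ₂ lo hi δ RS hRS φ₁ hφ₁ σ τ hσ hτ s2 t2 h
              · rw [if_neg tb] at h; exact (S₂_ne_L₂ F₁ F₂ s₁ s₂ RS φ₁ τ σ t2 sb h.symm).elim
            · rw [if_neg t2] at h; exact (N_ne_L₂ F₁ F₂ s₁ s₂ J₁ J₂ hJ₂ lo hi δ RS hRS φ₁ τ σ hτ hσ t2 s2 h.symm).elim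
        · rw [if_neg sb] at h
          by_cases t1 : ov₁ τ
          · rw [if_pos t1] at h
            by_cases tb : blk₁ τ
            · rw [if_pos tb] at h; exact (L₁_ne_S₂ F₁ F₂ s₁ s₂ J₁ J₂ hJ₁ lo hi δ RS hRS φ₁ hφ₁ φ₂ τ σ hτ hσ t1 s2 h.symm).elim
            · rw [if_neg tb] at h; exact (S₁_ne_S₂ F₁ F₂ s₁ s₂ J₁ J₂ hJ₁ hh₁ hJ₂ hh₂ lo hi δ RS hRS φ₁ hφ₁ φ₂ hφ₂ τ σ hτ hσ t1 tb s2 h.symm).elim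
          · rw [if_neg t1] at h
            by_cases t2 : ov₂ τ
            · rw [if_pos t2] at h
              by_cases tb : blk₂ τ
              · rw [if_pos tb] at h; exact (S₂_ne_L₂ F₁ F₂ s₁ s₂ RS φ₁ σ τ s2 tb h).elim
              · rw [if_neg tb] at h; exact S₂_eq_S₂ F₁ F₂ s₁ s₂ J₁ J₂ hJ₁ lo hi δ RS hRS φ₁ hφ₁ σ τ hσ hτ s2 t2 h
            · rw [if_neg t2] at h; exact (N_ne_S₂ F₁ F₂ s₁ s₂ J₁ J₂ hJ₁ hJ₂ lo hi δ RS hRS φ₁ hφ₁ τ σ hτ hσ t1 t2 s2 sb h.symm).elim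
      · rw [if_neg s2] at h
        by_cases t1 : ov₁ τ
        · rw [if_pos t1] at h
          by_cases tb : blk₁ τ
          · rw [if_pos tb] at h; exact (N_ne_L₁ F₁ F₂ s₁ s₂ J₁ J₂ hJ₁ lo hi δ RS hRS φ₂ σ τ hσ hτ s1 t1 h).elim
          · rw [if_neg tb] at h; exact (N_ne_S₁ F₁ F₂ s₁ s₂ J₁ J₂ hJ₁ hJ₂ lo hi δ RS hRS φ₂ hφ₂ σ τ hσ hτ s1 s2 t1 tb h).elim
        · rw [if_neg t1] at h
          by_cases t2 : ov₂ τ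
          · rw [if_pos t2] at h
            by_cases tb : blk₂ τ
            · rw [if_pos tb] at h; exact (N_ne_L₂ F₁ F₂ s₁ s₂ J₁ J₂ hJ₂ lo hi δ RS hRS φ₁ σ τ hσ hτ s2 t2 h).elim
            · rw [if_neg tb] at h; exact (N_ne_S₂ F₁ F₂ s₁ s₂ J₁ J₂ hJ₁ hJ₂ lo hi δ RS hRS φ₁ hφ₁ σ τ hσ hτ s1 s2 t2 tb h).elim
          · rw [if_neg t2] at h; exact N_eq_N F₁ F₂ s₁ s₂ J₁ J₂ hJ₁ hJ₂ lo hi δ RS hRS σ τ hσ hτ h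
  exact card_le_card_of_injOn Ψ (fun σ hσ => hmaps σ hσ) hinj

end Main

end TwoFlatPLD

end PercRepro
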